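import Literature.AnabelianGeometry.SemiGraphs.BTempQDPairCategoryPGen
import HarnessLib

/-!
# Semi-graphs of anabelioids, Appendix, proof of Theorem A.4: the strongly connected core
# `P⁰ ⊆ P` — `Hom^` of a strongly connected pair inside the `Hom^` of arbitrary pairs

Mochizuki, *Semi-graphs of anabelioids*, Publ. RIMS **42** (2006) 221–322, Appendix, proof of
Theorem A.4, manuscript pp. 84–85 (PRIMS p. 314 l. 9 – p. 315 l. 12)
[cite: MochizukiSemiAnbd2006, Thm A.4 proof pp.84-85]: the `Hom^` of STRONGLY connected pairs
(p. 84 ll. 1–8) is extended to weakly connected and then arbitrary pairs through "the strongly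
connected QD-pair `(B′, Γ_B′)`" of each component ("each connected component `B′` of `B` determines a
strongly connected QD-pair `(B′, Γ_B′)` … such that `q_i((B′, Γ_B′)) ≅ q_i((B, Γ_B))`"), and `P_i` is
"the category whose objects are the objects of `D_i` and whose morphisms are given by the `Hom^`'s".

CONSISTENCY of the two kernel renderings of `P_i` in the tree (seat abc-iut-w4-d089, follow-up to rows
A4-lim-P-core / A4-lim-gen / A4-lim-P-full of `plan/L3/SUBDAG-SemiAnbd-Cor311.md`): abc-iut-w4-d081's
core `QDPair.PCore κ₀` (objects strongly connected, `Hom := HomHat`) sits inside `QDPair.PGen κ`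
(objects all pairs, `Hom := HomHatGen`) as a FULL SUBCATEGORY, compatibly with the comparison functors
to `T = B^temp(Π)` — for ANY topological group `Π` (no temperedness):

* `QDPair.isoOfHom` — a morphism of QD-pairs whose arrow is an isomorphism and along which `Γ` lifts
  is an isomorphism of QD-pairs; `QDPair.componentInclIso` — for `(B, Γ_B)` STRONGLY connected, the
  component inclusion `(B′_b, Γ_{B′_b}) → (B, Γ_B)` is an isomorphism of QD-pairs (`B` is one orbit);
* **`HomHatGen.ofCore`** — `Hom^((B, Γ_B), (C, Γ_C)) → HomHatGen((B, Γ_B), (C, Γ_C))`, transport the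
  class to each component along `(B′_b, Γ) ⥲ (B, Γ_B)`; `toHom_ofCore : toHom (ofCore x) =
  homHatToHom x`; `ofCore_bijective` (injective by `toHom_injective`, surjective by the matching);
* **`PCore.toPGen κ₀ κ : PCore κ₀ ⥤ PGen κ`** — full and faithful, with
  `PCore.toPGenCompToTIso : toPGen ⋙ PGen.toT κ ≅ PCore.toT κ₀`.

Elementary; nothing refers to the IUT corpus; no side is taken on any disputed claim.
-/

open CategoryTheory

namespace Literature.AnabelianGeometry.SemiGraphs

open Literature.AlgebraicGeometry.Frobenioids.QuasiTemperoid.BTempConnected (hom_ext_apply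
  nonempty_of_isConnectedObj exists_ρ_eq_of_isConnectedObj isIso_of_bijective)

universe v₁ u₁ u

namespace QDPair

/-! ### Morphisms of QD-pairs that are isomorphisms -/

section General

variable {Q : Type u₁} [Category.{v₁} Q]

/-- **A morphism of QD-pairs `f : (B₁, Γ₁) → (B₂, Γ₂)` whose arrow is an isomorphism of `Q` and along
which every `γ₂ ∈ Γ₂` lifts (`f ≫ γ₂ = γ₁ ≫ f`) is an isomorphism of QD-pairs** (the inverse arrow
descends `γ₂` to `γ₁`). [cite: MochizukiSemiAnbd2006, Def A.3(ii) p.82] -/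
noncomputable def isoOfHom {P₁ P₂ : QDPair Q} (f : P₁ ⟶ P₂) [IsIso f.hom]
    (hlift : ∀ γ₂ ∈ P₂.Γ, ∃ γ₁ ∈ P₁.Γ, f.hom ≫ γ₂.hom = γ₁.hom ≫ f.hom) : P₁ ≅ P₂ where
  hom := f
  inv := ⟨inv f.hom, fun γ₂ hγ₂ => by
    obtain ⟨γ₁, hγ₁, h⟩ := hlift γ₂ hγ₂
    refine ⟨γ₁, hγ₁, ?_⟩
    rw [IsIso.inv_comp_eq, ← Category.assoc, h, Category.assoc, IsIso.hom_inv_id, Category.comp_id]⟩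
  hom_inv_id := Hom.ext (IsIso.hom_inv_id f.hom)
  inv_hom_id := Hom.ext (IsIso.inv_hom_id f.hom)

/-- `isoOfHom` has the given morphism as `hom`. [cite: MochizukiSemiAnbd2006, Def A.3(ii) p.82] -/
@[simp] theorem isoOfHom_hom {P₁ P₂ : QDPair Q} (f : P₁ ⟶ P₂) [IsIso f.hom]
    (hlift : ∀ γ₂ ∈ P₂.Γ, ∃ γ₁ ∈ P₁.Γ, f.hom ≫ γ₂.hom = γ₁.hom ≫ f.hom) :
    (isoOfHom f hlift).hom = f := rfl

end General

/-! ### A strongly connected pair IS the pair of its (unique) component -/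

section Core

variable {G : Type u} [Group G] [TopologicalSpace G]

/-- For `B` connected (one `Π`-orbit) the component inclusion `B′_b → B` is bijective on points, hence
an isomorphism of `B^temp(Π)`. [cite: MochizukiSemiAnbd2006, Thm A.4 proof p.84] -/
theorem isIso_componentIncl_hom (P : QDPair (BTemp G)) (hP : P.IsStronglyConnected) (b : P.A.obj.V) :
    IsIso (P.componentIncl b).hom := by
  refine isIso_of_bijective _ ⟨BTemp.orbitIncl_injective P.A b, fun x => ?_⟩
  obtain ⟨a, ha⟩ := exists_ρ_eq_of_isConnectedObj P.A hP b x
  exact ⟨⟨x, a, ha⟩, rfl⟩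

/-- For `B` connected every `γ ∈ Γ_B` stabilises the (only) component `[B′_b]`.
[cite: MochizukiSemiAnbd2006, Thm A.4 proof p.84] -/
theorem mem_stabOrbit_of_isStronglyConnected (P : QDPair (BTemp G)) (hP : P.IsStronglyConnected)
    (b : P.A.obj.V) (γ : Aut P.A) : γ ∈ BTemp.stabOrbit P.A b :=
  exists_ρ_eq_of_isConnectedObj P.A hP b _

/-- **For `(B, Γ_B)` STRONGLY connected, `(B′_b, Γ_{B′_b}) → (B, Γ_B)` is an isomorphism of QD-pairs**
(`B′_b = B` as a `Π`-set and `Γ_{B′_b} = Γ_B` restricted: every `γ ∈ Γ_B` lifts to its restriction).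
[cite: MochizukiSemiAnbd2006, Thm A.4 proof p.84] -/
noncomputable def componentInclIso (P : QDPair (BTemp G)) (hP : P.IsStronglyConnected)
    (b : P.A.obj.V) : P.componentPair b ≅ P :=
  haveI := isIso_componentIncl_hom P hP b
  isoOfHom (P.componentIncl b) fun γ hγ =>
    ⟨BTemp.restrictOrbit P.A b ⟨γ, mem_stabOrbit_of_isStronglyConnected P hP b γ⟩,
      P.restrictOrbit_mem_componentGroup b ⟨γ, _⟩ hγ, (BTemp.restrictOrbit_incl P.A b ⟨γ, _⟩).symm⟩

/-- `componentInclIso` on `hom` is the component inclusion. [cite: MochizukiSemiAnbd2006, Thm A.4 proof p.84] -/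
@[simp] theorem componentInclIso_hom (P : QDPair (BTemp G)) (hP : P.IsStronglyConnected)
    (b : P.A.obj.V) : (componentInclIso P hP b).hom = P.componentIncl b := rfl

/-- Moving the base point: `(B′_b ⥲ B)⁻¹ ≫ (B′_b ⥲ B′_{b′}) = γ ≫ (B′_{b′} ⥲ B)⁻¹` as isomorphisms of
QD-pairs, for `γ ∈ Γ_B` with `γ b ∈ Π·b′` (the square `componentHom_comp_incl`).
[cite: MochizukiSemiAnbd2006, Thm A.4 proof p.84] -/
theorem componentInclIso_symm_trans_componentIso (P : QDPair (BTemp G)) (hP : P.IsStronglyConnected)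
    {b b' : P.A.obj.V} (γ : Aut P.A) (h : ∃ a : G, P.A.obj.ρ a b' = (γ.hom.hom.hom b : P.A.obj.V))
    (hγ : γ ∈ P.Γ) :
    (componentInclIso P hP b).symm ≪≫ componentIso γ h hγ =
      autOfMem P γ hγ ≪≫ (componentInclIso P hP b').symm := by
  ext1
  rw [Iso.trans_hom, Iso.trans_hom, Iso.symm_hom, Iso.symm_hom, Iso.inv_comp_eq, ← Category.assoc,
    Iso.eq_comp_inv]
  exact componentHom_comp_incl γ h hγ

end Core

/-! ### `Hom^` of a strongly connected pair inside `HomHatGen` -/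

namespace HomHatGen

variable {G : Type u} [Group G] [TopologicalSpace G] {P C : QDPair (BTemp G)}

/-- **`Hom^((B, Γ_B), (C, Γ_C)) → HomHatGen((B, Γ_B), (C, Γ_C))` for `(B, Γ_B)` strongly connected**:
transport the class to each component along `(B′_b, Γ_{B′_b}) ⥲ (B, Γ_B)`; the family matches because
two base points differ by `γ ∈ Γ_B`, which acts trivially on `Hom^` (`HomHat.map_autOfMem_id`).
[cite: MochizukiSemiAnbd2006, Thm A.4 proof pp.84-85] -/
noncomputable def ofCore (hP : P.IsStronglyConnected) (x : HomHat P C) : HomHatGen P C :=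
  ⟨fun b => HomHat.map (componentInclIso P hP b).symm (𝟙 C) x, by
    intro b b' γ hγ h
    have ht := HomHat.map_trans (componentInclIso P hP b).symm (componentIso γ h hγ) (𝟙 C) (𝟙 C) x
    rw [← ht, componentInclIso_symm_trans_componentIso P hP γ h hγ, HomHat.map_trans,
      HomHat.map_autOfMem_id]⟩

/-- `ofCore` at `b`. [cite: MochizukiSemiAnbd2006, Thm A.4 proof pp.84-85] -/
theorem proj_ofCore (hP : P.IsStronglyConnected) (x : HomHat P C) (b : P.A.obj.V) :
    (ofCore hP x).proj b = HomHat.map (componentInclIso P hP b).symm (𝟙 C) x := rfl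

variable [IsTopologicalGroup G]

/-- The comparison arrows agree: **`toHom (ofCore x) = homHatToHom x`** (restrict to the component
`B′_b ⥲ B` and cancel the isomorphism `q(B′_b ⥲ B)`). [cite: MochizukiSemiAnbd2006, Thm A.4 proof pp.84-85] -/
theorem toHom_ofCore (hP : P.IsStronglyConnected) (x : HomHat P C) :
    toHom (ofCore hP x) = homHatToHom P C x := by
  obtain ⟨b⟩ := nonempty_of_isConnectedObj P.A hP
  haveI := isIso_orbitQuotientMap_iso (componentInclIso P hP b)
  rw [← cancel_epi (orbitQuotientMap (componentInclIso P hP b).hom)]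
  change orbitQuotientMap (P.componentIncl b) ≫ toHom (ofCore hP x) = _
  rw [orbitQuotientMap_incl_toHom, proj_ofCore, homHatToHom_map_id]
  rfl

omit [IsTopologicalGroup G] in
/-- Going back: the `b`-component transported along `B′_b ⥲ B` recovers the family's value on ANY
component (the two transports compose to the matching along `γ_B = 1`).
[cite: MochizukiSemiAnbd2006, Thm A.4 proof pp.84-85] -/
theorem ofCore_map_proj (hP : P.IsStronglyConnected) (y : HomHatGen P C) (b : P.A.obj.V) :
    ofCore hP (HomHat.map (componentInclIso P hP b) (𝟙 C) (y.proj b)) = y := by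
  ext b'
  rw [proj_ofCore, ← HomHat.map_trans]
  -- `(B′_b ⥲ B) ≫ (B′_{b′} ⥲ B)⁻¹ = componentIso 1`
  have h1 : ∃ a : G, P.A.obj.ρ a b' = ((1 : Aut P.A).hom.hom.hom b : P.A.obj.V) :=
    exists_ρ_eq_of_isConnectedObj P.A hP b' _
  have key : componentInclIso P hP b ≪≫ (componentInclIso P hP b').symm =
      componentIso 1 h1 P.Γ.one_mem := by
    have h2 := componentInclIso_symm_trans_componentIso P hP (b := b) (b' := b') 1 h1 P.Γ.one_mem
    have h3 : autOfMem P 1 P.Γ.one_mem = Iso.refl P := Iso.ext (Hom.ext rfl)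
    rw [h3, Iso.refl_trans] at h2
    rw [← h2, ← Iso.trans_assoc, Iso.self_symm_id, Iso.refl_trans]
  rw [key, Category.comp_id]
  exact y.map_proj 1 P.Γ.one_mem h1

omit [IsTopologicalGroup G] in
/-- `ofCore` is injective. [cite: MochizukiSemiAnbd2006, Thm A.4 proof pp.84-85] -/
theorem ofCore_injective (hP : P.IsStronglyConnected) : Function.Injective (ofCore (C := C) hP) := by
  intro x x' h
  obtain ⟨b⟩ := nonempty_of_isConnectedObj P.A hP
  have hb := congrArg (fun y : HomHatGen P C => y.proj b) h
  simp only [proj_ofCore] at hb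
  exact (HomHat.map_bijective (componentInclIso P hP b).symm (Iso.refl C)).1 hb

omit [IsTopologicalGroup G] in
/-- `ofCore` is surjective: a matching family of a strongly connected pair is the transport of its
value on any one component. [cite: MochizukiSemiAnbd2006, Thm A.4 proof pp.84-85] -/
theorem ofCore_surjective (hP : P.IsStronglyConnected) : Function.Surjective (ofCore (C := C) hP) := by
  intro y
  obtain ⟨b⟩ := nonempty_of_isConnectedObj P.A hP
  exact ⟨_, ofCore_map_proj hP y b⟩

omit [IsTopologicalGroup G] in
/-- **`Hom^((B, Γ_B), (C, Γ_C)) ≅ HomHatGen((B, Γ_B), (C, Γ_C))` for `(B, Γ_B)` strongly connected** (any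
`Π`): the two renderings of the `Hom`-sets of `P_i` agree on the core.
[cite: MochizukiSemiAnbd2006, Thm A.4 proof pp.84-85] -/
theorem ofCore_bijective (hP : P.IsStronglyConnected) : Function.Bijective (ofCore (C := C) hP) :=
  ⟨ofCore_injective hP, ofCore_surjective hP⟩

end HomHatGen

/-! ### The full embedding `P⁰ ⥤ P` -/

namespace PCore

variable {G : Type u} [Group G] [TopologicalSpace G] [IsTopologicalGroup G]
  (κ₀ : HomHatCompLaw G) (κ : HomHatGenCompLaw G)

/-- **The embedding of the strongly connected core `P⁰ = PCore κ₀` into `P = PGen κ`**: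
`(B, Γ_B) ↦ (B, Γ_B)`, `x ↦ ofCore x`; functorial because both composition laws are compatible with
`q` and `Hom^ → Hom_T` is injective. [cite: MochizukiSemiAnbd2006, Thm A.4 proof p.85] -/
noncomputable def toPGen : PCore κ₀ ⥤ PGen κ where
  obj P := ⟨P.pair⟩
  map {P C} x := (HomHatGen.ofCore (C := C.pair) P.isStronglyConnected x : HomHatGen P.pair C.pair)
  map_id P := HomHatGen.toHom_injective (by
    change HomHatGen.toHom (HomHatGen.ofCore P.isStronglyConnected (idHat P)) =
      HomHatGen.toHom (HomHatGen.ofHom (𝟙 P.pair))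
    rw [HomHatGen.toHom_ofCore, homHatToHom_idHat, HomHatGen.toHom_ofHom]
    exact ((orbitQuotientFunctor (G := G)).map_id P.pair).symm)
  map_comp {P₁ P₂ P₃} x y := HomHatGen.toHom_injective (by
    change HomHatGen.toHom (HomHatGen.ofCore P₁.isStronglyConnected (compHat x y)) =
      HomHatGen.toHom (κ.comp (HomHatGen.ofCore P₁.isStronglyConnected x)
        (HomHatGen.ofCore P₂.isStronglyConnected y))
    rw [HomHatGen.toHom_ofCore, homHatToHom_compHat, κ.toHom_comp, HomHatGen.toHom_ofCore,
      HomHatGen.toHom_ofCore])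

/-- `P⁰ ⥤ P` on morphisms is `ofCore`. [cite: MochizukiSemiAnbd2006, Thm A.4 proof p.85] -/
theorem toPGen_map {P C : PCore κ₀} (x : P ⟶ C) :
    (toPGen κ₀ κ).map x = HomHatGen.ofCore (C := C.pair) P.isStronglyConnected x := rfl

/-- **`P⁰ ⥤ P` is faithful.** [cite: MochizukiSemiAnbd2006, Thm A.4 proof p.85] -/
instance faithful_toPGen : (toPGen κ₀ κ).Faithful :=
  ⟨fun {P _} => HomHatGen.ofCore_injective P.isStronglyConnected⟩

/-- **`P⁰ ⥤ P` is full.** [cite: MochizukiSemiAnbd2006, Thm A.4 proof p.85] -/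
instance full_toPGen : (toPGen κ₀ κ).Full :=
  ⟨fun {P _} => HomHatGen.ofCore_surjective P.isStronglyConnected⟩

/-- **`P⁰ ⥤ P ⥤ T` is `P⁰ ⥤ T`** (identity components; on arrows `toHom (ofCore x) = homHatToHom x`).
[cite: MochizukiSemiAnbd2006, Thm A.4 proof p.85] -/
noncomputable def toPGenCompToTIso : toPGen κ₀ κ ⋙ PGen.toT κ ≅ toT κ₀ :=
  NatIso.ofComponents (fun _ => Iso.refl _) fun {P C} x => by
    change HomHatGen.toHom (HomHatGen.ofCore P.isStronglyConnected x) ≫ 𝟙 _ =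
      𝟙 _ ≫ homHatToHom P.pair C.pair x
    rw [Category.comp_id, Category.id_comp, HomHatGen.toHom_ofCore]

end PCore

end QDPair

end Literature.AnabelianGeometry.SemiGraphs
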